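import Mathlib
import Summits.ValiantsHypothesis.ValiantsHypothesis.Theorems.ValuativeGCTHeadFlipRankBoundDefs
import Summits.ValiantsHypothesis.ValiantsHypothesis.Theorems.ValuativeGCTHeadFlipRankBoundDefsB
import Summits.ValiantsHypothesis.ValiantsHypothesis.Theorems.ValuativeGCTHeadFlipRankBoundESymm
import Summits.ValiantsHypothesis.ValiantsHypothesis.Theorems.ValuativeGCTHeadFlipRankBoundPoints
import Summits.ValiantsHypothesis.ValiantsHypothesis.Theorems.ValuativeGCTValuativeFlipRankOneMaster
import Summits.ValiantsHypothesis.ValiantsHypothesis.Theorems.ValuativeGCTValuativeFlipRankOneV1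
import Summits.ValiantsHypothesis.ValiantsHypothesis.Theorems.ValuativeGCTValuativeFlipRankOneBRelations

/-!
# The four-multiplier count for the rank-one moment-curve pencil: rank `≥ 3n² - 13n`
# (crux `ValuativeGCT.ValuativeFlip`, stub `stub_fourRowPencilRank`)

Wall-breaker k1 (explicit per-side constructions), crux stmt-ValiantsHypothesis-12624, line
`four-row-count`.  Fourth file: the `4n²` products `y_t · Per_ab` (`t < 4`) of the rank-one
moment-curve pencil of the HeadFlip line span at least `3n² - 13n` dimensions for `n ≥ 3`
(`mcp_finrank_span_ge`; numerically the value is `3n² - 3n + 2`).  The relation space (kernel of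
`c ↦ Σ c_ι · y_t Per_ab`) maps injectively (`mcp_relation_eq_zero`) to the bookkeeping space
`(diagonal A-coefficients) × (A·B-coefficients of the apex quadratics q_{α_r b}, three apexes) ×
(y₃y₁-coefficient of q_ab, a < b) × (y₁-coefficient c(1,(a,b)), a < b)` of dimension
`2n + 12n + C(n,2) + C(n,2) = n² + 13n`: on its kernel, V1 (`mcp_V1`) at the three points `p_{α_r i j}`
and `stub_rbV2` kill every `q_ij`, `stub_rbV4` turns this into `c(0,·) = c(3,·) = 0`, and the remaining
`B`-relation is trivial by `mcp_B_relations`.  Rank–nullity gives the count.  The HeadFlip blueprint's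
three-multiplier count (`14n + C(n,2)`, rank `≥ 2.5n²`) is the same argument without the last factor.
No definitions. [this crux; new]
-/

-- `Summit.ValiantsHypothesis.ValiantsHypothesis.…` is the tree's mandated single-conjunct layout (Sub = Summit).
set_option linter.dupNamespace false

namespace Summit.ValiantsHypothesis.ValiantsHypothesis.Theorems.ValuativeFlip

open MvPolynomial Finset
open scoped BigOperators
open Summit.ValiantsHypothesis.ValiantsHypothesis.Theorems.HeadFlip

noncomputable section

/-! ### Coefficient extraction for the four `A·B` monomials -/

/-- The four monomials `y₃y₁, y₃y₂, y₀y₁, y₀y₂` are linearly independent (evaluate at four points).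
[folklore] -/
theorem mcp_AB_coeffs_zero (c₀₀ c₀₁ c₁₀ c₁₁ : ℂ)
    (h : c₀₀ • (X 3 * X 1 : MvPolynomial (Fin 4) ℂ) + c₀₁ • (X 3 * X 2 : MvPolynomial (Fin 4) ℂ) +
      c₁₀ • (X 0 * X 1 : MvPolynomial (Fin 4) ℂ) + c₁₁ • (X 0 * X 2 : MvPolynomial (Fin 4) ℂ) = 0) :
    c₀₀ = 0 ∧ c₀₁ = 0 ∧ c₁₀ = 0 ∧ c₁₁ = 0 := by
  have e := fun y : Fin 4 → ℂ => congrArg (MvPolynomial.eval y) h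
  have e1 := e ![0, 1, 0, 1]
  have e2 := e ![0, 0, 1, 1]
  have e3 := e ![1, 1, 0, 0]
  have e4 := e ![1, 0, 1, 0]
  simp only [map_add, MvPolynomial.smul_eval, map_mul, MvPolynomial.eval_X, map_zero, Matrix.cons_val_zero,
    Matrix.cons_val_one, Matrix.head_cons, Matrix.cons_val_two, Matrix.tail_cons, Matrix.cons_val_three,
    mul_one, mul_zero, add_zero, zero_add] at e1 e2 e3 e4
  exact ⟨e1, e2, e3, e4⟩

/-- The symmetrised quadratic `q_ab = L_ab u_b + L_ba u_a` of the `A`-part `L_ab = c₀ y₀ + c₃ y₃` of a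
coefficient vector, expanded on the four `A·B` monomials (as `rbQq_expand`). [this crux] -/
theorem mcp_q_expand {n : ℕ} (c : Fin 4 × (Fin n × Fin n) → ℂ) (a b : Fin n) :
    (c (0, (a, b)) • (X 0 : MvPolynomial (Fin 4) ℂ) + c (3, (a, b)) • (X 3 : MvPolynomial (Fin 4) ℂ)) * rbU b +
      (c (0, (b, a)) • (X 0 : MvPolynomial (Fin 4) ℂ) + c (3, (b, a)) • (X 3 : MvPolynomial (Fin 4) ℂ)) * rbU a =
      (c (3, (a, b)) * rbA b ^ 2 + c (3, (b, a)) * rbA a ^ 2) • (X 3 * X 1 : MvPolynomial (Fin 4) ℂ) +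
      (c (3, (a, b)) * rbA b ^ 3 + c (3, (b, a)) * rbA a ^ 3) • (X 3 * X 2 : MvPolynomial (Fin 4) ℂ) +
      (c (0, (a, b)) * rbA b ^ 2 + c (0, (b, a)) * rbA a ^ 2) • (X 0 * X 1 : MvPolynomial (Fin 4) ℂ) +
      (c (0, (a, b)) * rbA b ^ 3 + c (0, (b, a)) * rbA a ^ 3) • (X 0 * X 2 : MvPolynomial (Fin 4) ℂ) := by
  simp only [rbU, rbUv, Fin.sum_univ_four, Matrix.cons_val_zero, Matrix.cons_val_one, Matrix.head_cons,
    Matrix.cons_val_two, Matrix.tail_cons, Matrix.cons_val_three, MvPolynomial.smul_eq_C_mul, map_add, map_mul,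
    map_pow, map_zero]
  ring

/-! ### A relation with vanishing bookkeeping data is trivial -/

/-- **Injectivity of the bookkeeping map on relations** (four multipliers).  Let `c` be the
coefficient vector of a relation among the `4n²` products `y_t · Per_ab` (`n ≥ 3`; apexes
`α_r = Fin.castLE h3 r`, `r < 3`).  If the diagonal `A`-coefficients `c(0,(a,a))`, `c(3,(a,a))` vanish, the
four `A·B` coefficients of every apex quadratic `q_{α_r b}` vanish, the `y₃y₁`-coefficient of `q_ab`
vanishes for all `a < b`, and the `y₁`-coefficient `c(1,(a,b))` vanishes for all `a < b`, then `c = 0`: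
V1 at the three points `p_{α_r i j}` and `stub_rbV2` kill every `q_ij`, `stub_rbV4` turns `q ≡ 0` into
`c(0,·) = c(3,·) = 0`, and the remaining `B`-relation is trivial by `mcp_B_relations`. [this crux; new] -/
theorem mcp_relation_eq_zero {n : ℕ} (h3 : 3 ≤ n) (c : Fin 4 × (Fin n × Fin n) → ℂ)
    (hrel : ∑ ι : Fin 4 × (Fin n × Fin n), c ι • ((X ι.1 : MvPolynomial (Fin 4) ℂ) * rbPer ι.2.1 ι.2.2) = 0)
    (h0d : ∀ a, c (0, (a, a)) = 0) (h3d : ∀ a, c (3, (a, a)) = 0)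
    (hq : ∀ (r : Fin 3) (b : Fin n),
        c (3, (Fin.castLE h3 r, b)) * rbA b ^ 2 + c (3, (b, Fin.castLE h3 r)) * rbA (Fin.castLE h3 r) ^ 2 = 0 ∧
        c (3, (Fin.castLE h3 r, b)) * rbA b ^ 3 + c (3, (b, Fin.castLE h3 r)) * rbA (Fin.castLE h3 r) ^ 3 = 0 ∧
        c (0, (Fin.castLE h3 r, b)) * rbA b ^ 2 + c (0, (b, Fin.castLE h3 r)) * rbA (Fin.castLE h3 r) ^ 2 = 0 ∧
        c (0, (Fin.castLE h3 r, b)) * rbA b ^ 3 + c (0, (b, Fin.castLE h3 r)) * rbA (Fin.castLE h3 r) ^ 3 = 0)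
    (hκ : ∀ a b : Fin n, a < b → c (3, (a, b)) * rbA b ^ 2 + c (3, (b, a)) * rbA a ^ 2 = 0)
    (hΘ : ∀ a b : Fin n, a < b → c (1, (a, b)) = 0) : c = 0 := by
  -- the `A`- and `B`-parts of the coefficient vector
  set L : Fin n → Fin n → MvPolynomial (Fin 4) ℂ :=
    fun a b => c (0, (a, b)) • (X 0 : MvPolynomial (Fin 4) ℂ) + c (3, (a, b)) • (X 3 : MvPolynomial (Fin 4) ℂ) with hL
  set M : Fin n → Fin n → MvPolynomial (Fin 4) ℂ :=
    fun a b => c (1, (a, b)) • (X 1 : MvPolynomial (Fin 4) ℂ) + c (2, (a, b)) • (X 2 : MvPolynomial (Fin 4) ℂ) with hM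
  have hrel' : ∑ a, ∑ b, (L a b + M a b) * rbPer a b = 0 := by
    rw [Fintype.sum_prod_type, Finset.sum_comm, Fintype.sum_prod_type] at hrel
    rw [← hrel]
    refine Finset.sum_congr rfl fun a _ => Finset.sum_congr rfl fun b _ => ?_
    rw [Fin.sum_univ_four]
    simp only [hL, hM, add_mul, smul_mul_assoc]
    abel
  have hLw : ∀ a b, MvPolynomial.IsWeightedHomogeneous (![0, 1, 1, 0] : Fin 4 → ℕ) (L a b) 0 := by
    intro a b
    have h0 : MvPolynomial.IsWeightedHomogeneous (![0, 1, 1, 0] : Fin 4 → ℕ) (X 0 : MvPolynomial (Fin 4) ℂ) 0 := by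
      simpa using isWeightedHomogeneous_X ℂ (![0, 1, 1, 0] : Fin 4 → ℕ) 0
    have h3' : MvPolynomial.IsWeightedHomogeneous (![0, 1, 1, 0] : Fin 4 → ℕ) (X 3 : MvPolynomial (Fin 4) ℂ) 0 := by
      simpa using isWeightedHomogeneous_X ℂ (![0, 1, 1, 0] : Fin 4 → ℕ) 3
    simp only [hL, MvPolynomial.smul_eq_C_mul]
    exact (h0.C_mul _).add (h3'.C_mul _)
  have hMw : ∀ a b, MvPolynomial.IsWeightedHomogeneous (![0, 1, 1, 0] : Fin 4 → ℕ) (M a b) 1 :=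
    fun a b => mcp_linB_isWeightedHomogeneous _ _
  -- the four coefficient identities of `q_ij`, for every `i ≠ j`
  have hcoef : ∀ i j : Fin n, i ≠ j →
      c (3, (i, j)) * rbA j ^ 2 + c (3, (j, i)) * rbA i ^ 2 = 0 ∧
      c (3, (i, j)) * rbA j ^ 3 + c (3, (j, i)) * rbA i ^ 3 = 0 ∧
      c (0, (i, j)) * rbA j ^ 2 + c (0, (j, i)) * rbA i ^ 2 = 0 ∧
      c (0, (i, j)) * rbA j ^ 3 + c (0, (j, i)) * rbA i ^ 3 = 0 := by
    -- apex pairs first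
    have hapex : ∀ (r : Fin 3) (b : Fin n), Fin.castLE h3 r ≠ b →
        L (Fin.castLE h3 r) b * rbU b + L b (Fin.castLE h3 r) * rbU (Fin.castLE h3 r) = 0 := by
      intro r b _
      obtain ⟨e1, e2, e3, e4⟩ := hq r b
      simp only [hL]
      rw [mcp_q_expand c, e1, e2, e3, e4, zero_smul, zero_smul, zero_smul, zero_smul, add_zero, add_zero, add_zero]
    intro i j hij
    -- symmetric form of the goal
    suffices hsym : ∀ i j : Fin n, i ≠ j → (∀ r : Fin 3, Fin.castLE h3 r ≠ j) →
        c (3, (i, j)) * rbA j ^ 2 + c (3, (j, i)) * rbA i ^ 2 = 0 ∧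
        c (3, (i, j)) * rbA j ^ 3 + c (3, (j, i)) * rbA i ^ 3 = 0 ∧
        c (0, (i, j)) * rbA j ^ 2 + c (0, (j, i)) * rbA i ^ 2 = 0 ∧
        c (0, (i, j)) * rbA j ^ 3 + c (0, (j, i)) * rbA i ^ 3 = 0 by
      by_cases hj : ∃ r : Fin 3, Fin.castLE h3 r = j
      · obtain ⟨r, rfl⟩ := hj
        by_cases hi : ∃ r' : Fin 3, Fin.castLE h3 r' = i
        · obtain ⟨r', rfl⟩ := hi
          obtain ⟨e1, e2, e3, e4⟩ := hq r' (Fin.castLE h3 r)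
          exact ⟨e1, e2, e3, e4⟩
        · push Not at hi
          obtain ⟨e1, e2, e3, e4⟩ := hsym (Fin.castLE h3 r) i hij.symm hi
          refine ⟨?_, ?_, ?_, ?_⟩
          · linear_combination e1
          · linear_combination e2
          · linear_combination e3
          · linear_combination e4
      · push Not at hj
        exact hsym i j hij hj
    intro i j hij hj
    by_cases hi : ∃ r : Fin 3, Fin.castLE h3 r = i
    · obtain ⟨r, rfl⟩ := hi
      exact hq r j
    push Not at hi
    -- neither `i` nor `j` is an apex: V1 at the three points `p_{α_r i j}`
    have hV : ∀ r : Fin 3, MvPolynomial.eval (rbPt (Fin.castLE h3 r) i j) (L i j * rbU j + L j i * rbU i) = 0 := by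
      intro r
      have hαi : Fin.castLE h3 r ≠ i := hi r
      have hαj : Fin.castLE h3 r ≠ j := hj r
      have h := mcp_V1 L M hLw hMw hrel' (Fin.castLE h3 r) i j hαi hαj hij
      rw [hapex r i hαi, hapex r j hαj, zero_mul, zero_mul, zero_add, zero_add, map_mul,
        rbU_eval_rbPt] at h
      exact (mul_eq_zero.1 h).resolve_right (mul_ne_zero (pow_ne_zero _ (rbA_ne_zero _)) (rbA_add_ne_zero i j))
    have h00 : c (3, (i, j)) * rbA j ^ 2 + c (3, (j, i)) * rbA i ^ 2 = 0 := by
      rcases lt_or_gt_of_ne hij with h | h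
      · exact hκ i j h
      · linear_combination hκ j i h
    have hinj : Function.Injective (fun r : Fin 3 => Fin.castLE h3 r) := fun r r' h => Fin.castLE_injective h3 h
    obtain ⟨e2, e3, e4⟩ := stub_rbV2 i j (fun r : Fin 3 => Fin.castLE h3 r) hij hinj (fun r => ⟨hi r, hj r⟩)
      (c (3, (i, j)) * rbA j ^ 2 + c (3, (j, i)) * rbA i ^ 2) (c (3, (i, j)) * rbA j ^ 3 + c (3, (j, i)) * rbA i ^ 3)
      (c (0, (i, j)) * rbA j ^ 2 + c (0, (j, i)) * rbA i ^ 2) (c (0, (i, j)) * rbA j ^ 3 + c (0, (j, i)) * rbA i ^ 3)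
      (fun r => by rw [← mcp_q_expand c i j]; exact hV r) h00
    exact ⟨h00, e2, e3, e4⟩
  -- hence the `A`-part vanishes
  have hc3 : ∀ a b, c (3, (a, b)) = 0 := by
    intro a b
    by_cases hab : a = b
    · subst hab; exact h3d a
    · exact (stub_rbV4 a b hab _ _ (hcoef a b hab).1 (hcoef a b hab).2.1).1
  have hc0 : ∀ a b, c (0, (a, b)) = 0 := by
    intro a b
    by_cases hab : a = b
    · subst hab; exact h0d a
    · exact (stub_rbV4 a b hab _ _ (hcoef a b hab).2.2.1 (hcoef a b hab).2.2.2).1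
  -- the remaining `B`-relation is trivial
  have hB : ∑ a, ∑ b, (c (1, (a, b)) • (X 1 : MvPolynomial (Fin 4) ℂ) + c (2, (a, b)) • (X 2 : MvPolynomial (Fin 4) ℂ)) *
      rbPer a b = 0 := by
    rw [← hrel']
    refine Finset.sum_congr rfl fun a _ => Finset.sum_congr rfl fun b _ => ?_
    simp only [hL, hM, hc0, hc3, zero_smul, add_zero, zero_add]
  obtain ⟨h1, h2⟩ := mcp_B_relations (fun a b => c (1, (a, b))) (fun a b => c (2, (a, b))) hB hΘ
  funext ⟨t, a, b⟩
  fin_cases t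
  · exact hc0 a b
  · exact congrFun (congrFun h1 a) b
  · exact congrFun (congrFun h2 a) b
  · exact hc3 a b

/-! ### The count -/

/-- Dimension of the bookkeeping target: `n + n + 12n + C(n,2) + C(n,2)`. [this crux] -/
theorem mcp_finrank_target (n : ℕ) :
    Module.finrank ℂ ((Fin n → ℂ) × ((Fin n → ℂ) × ((Fin 3 × Fin n → Fin 4 → ℂ) ×
      ((↥((Finset.univ : Finset (Fin n)).powersetCard 2) → ℂ) ×
        (↥((Finset.univ : Finset (Fin n)).powersetCard 2) → ℂ))))) = 14 * n + 2 * n.choose 2 := by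
  have h1 : Module.finrank ℂ (Fin n → ℂ) = n := by
    rw [Module.finrank_fintype_fun_eq_card, Fintype.card_fin]
  have h2 : Module.finrank ℂ (Fin 3 × Fin n → Fin 4 → ℂ) = 12 * n := by
    rw [Module.finrank_pi_fintype]
    simp only [Module.finrank_fintype_fun_eq_card, Fintype.card_fin, Finset.sum_const, Finset.card_univ,
      Fintype.card_prod, smul_eq_mul]
    ring
  have hp : Module.finrank ℂ (↥((Finset.univ : Finset (Fin n)).powersetCard 2) → ℂ) = n.choose 2 := by
    rw [Module.finrank_fintype_fun_eq_card, stub_rbCardPairs]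
  rw [Module.finrank_prod, Module.finrank_prod, Module.finrank_prod, Module.finrank_prod, h1, h2, hp]
  ring

/-- **The four-multiplier count.**  For `n ≥ 3` the `4n²` products `y_t · Per_ab` of the rank-one
moment-curve pencil span a space of dimension `≥ 3n² - 13n` (stated additively): the relation space is
the kernel of `c ↦ Σ c_ι · (y_t Per_ab)`, on which the bookkeeping map to a space of dimension
`14n + 2·C(n,2) = n² + 13n` is injective (`mcp_relation_eq_zero`); rank–nullity. (Numerically the
dimension is `3n² - 3n + 2`.) [this crux; new] -/
theorem mcp_finrank_span_ge : ∀ (n : ℕ), 3 ≤ n →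
    3 * n ^ 2 ≤ Module.finrank ℂ ↥(Submodule.span ℂ (Set.range fun tij : Fin 4 × (Fin n × Fin n) =>
      (X tij.1 : MvPolynomial (Fin 4) ℂ) * rbPer tij.2.1 tij.2.2)) + 13 * n := by
  intro n h3
  classical
  set v : Fin 4 × (Fin n × Fin n) → MvPolynomial (Fin 4) ℂ :=
    fun tij => (X tij.1 : MvPolynomial (Fin 4) ℂ) * rbPer tij.2.1 tij.2.2 with hv
  set Φ : (Fin 4 × (Fin n × Fin n) → ℂ) →ₗ[ℂ] MvPolynomial (Fin 4) ℂ := Fintype.linearCombination ℂ v with hΦ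
  have hrange : LinearMap.range Φ = Submodule.span ℂ (Set.range v) := Fintype.range_linearCombination ℂ v
  -- the unordered pairs and their extremes
  have hne : ∀ s : ↥((Finset.univ : Finset (Fin n)).powersetCard 2), s.1.Nonempty := fun s =>
    Finset.card_pos.1 (by rw [(Finset.mem_powersetCard.1 s.2).2]; norm_num)
  -- the bookkeeping map
  let ω0 : (Fin 4 × (Fin n × Fin n) → ℂ) →ₗ[ℂ] (Fin n → ℂ) :=
    LinearMap.pi fun a => LinearMap.proj ((0 : Fin 4), (a, a))
  let ω3 : (Fin 4 × (Fin n × Fin n) → ℂ) →ₗ[ℂ] (Fin n → ℂ) :=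
    LinearMap.pi fun a => LinearMap.proj ((3 : Fin 4), (a, a))
  let ωq : (Fin 4 × (Fin n × Fin n) → ℂ) →ₗ[ℂ] (Fin 3 × Fin n → Fin 4 → ℂ) :=
    LinearMap.pi fun rb => LinearMap.pi fun t =>
      (![rbA rb.2 ^ 2 • LinearMap.proj ((3 : Fin 4), (Fin.castLE h3 rb.1, rb.2)) +
          rbA (Fin.castLE h3 rb.1) ^ 2 • LinearMap.proj ((3 : Fin 4), (rb.2, Fin.castLE h3 rb.1)),
        rbA rb.2 ^ 3 • LinearMap.proj ((3 : Fin 4), (Fin.castLE h3 rb.1, rb.2)) +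
          rbA (Fin.castLE h3 rb.1) ^ 3 • LinearMap.proj ((3 : Fin 4), (rb.2, Fin.castLE h3 rb.1)),
        rbA rb.2 ^ 2 • LinearMap.proj ((0 : Fin 4), (Fin.castLE h3 rb.1, rb.2)) +
          rbA (Fin.castLE h3 rb.1) ^ 2 • LinearMap.proj ((0 : Fin 4), (rb.2, Fin.castLE h3 rb.1)),
        rbA rb.2 ^ 3 • LinearMap.proj ((0 : Fin 4), (Fin.castLE h3 rb.1, rb.2)) +
          rbA (Fin.castLE h3 rb.1) ^ 3 • LinearMap.proj ((0 : Fin 4), (rb.2, Fin.castLE h3 rb.1))] :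
        Fin 4 → ((Fin 4 × (Fin n × Fin n) → ℂ) →ₗ[ℂ] ℂ)) t
  let ωκ : (Fin 4 × (Fin n × Fin n) → ℂ) →ₗ[ℂ] (↥((Finset.univ : Finset (Fin n)).powersetCard 2) → ℂ) :=
    LinearMap.pi fun s =>
      rbA (s.1.max' (hne s)) ^ 2 • LinearMap.proj ((3 : Fin 4), (s.1.min' (hne s), s.1.max' (hne s))) +
        rbA (s.1.min' (hne s)) ^ 2 • LinearMap.proj ((3 : Fin 4), (s.1.max' (hne s), s.1.min' (hne s)))
  let ωΘ : (Fin 4 × (Fin n × Fin n) → ℂ) →ₗ[ℂ] (↥((Finset.univ : Finset (Fin n)).powersetCard 2) → ℂ) :=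
    LinearMap.pi fun s => LinearMap.proj ((1 : Fin 4), (s.1.min' (hne s), s.1.max' (hne s)))
  let Ω := ω0.prod (ω3.prod (ωq.prod (ωκ.prod ωΘ)))
  -- a relation with vanishing bookkeeping data is trivial
  have hker : ∀ c, Φ c = 0 → Ω c = 0 → c = 0 := by
    intro c hc hΩ
    have hrel : ∑ ι, c ι • v ι = 0 := by rwa [hΦ, Fintype.linearCombination_apply] at hc
    have h0 : ω0 c = 0 := by simpa [Ω] using congrArg Prod.fst hΩ
    have h3' : ω3 c = 0 := by simpa [Ω] using congrArg (fun x => x.2.1) hΩ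
    have hq : ωq c = 0 := by simpa [Ω] using congrArg (fun x => x.2.2.1) hΩ
    have hκ : ωκ c = 0 := by simpa [Ω] using congrArg (fun x => x.2.2.2.1) hΩ
    have hΘ : ωΘ c = 0 := by simpa [Ω] using congrArg (fun x => x.2.2.2.2) hΩ
    refine mcp_relation_eq_zero h3 c hrel (fun a => ?_) (fun a => ?_) (fun r b => ?_) (fun a b hab => ?_)
      (fun a b hab => ?_)
    · simpa [ω0] using congrFun h0 a
    · simpa [ω3] using congrFun h3' a
    · have e := fun t => congrFun (congrFun hq (r, b)) t
      have e0 := e 0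
      have e1 := e 1
      have e2 := e 2
      have e3 := e 3
      simp only [ωq, LinearMap.pi_apply, Matrix.cons_val_zero, Matrix.cons_val_one, Matrix.head_cons,
        Matrix.cons_val_two, Matrix.tail_cons, Matrix.cons_val_three, LinearMap.add_apply,
        LinearMap.smul_apply, LinearMap.proj_apply, Pi.zero_apply, smul_eq_mul] at e0 e1 e2 e3
      refine ⟨?_, ?_, ?_, ?_⟩
      · linear_combination e0
      · linear_combination e1
      · linear_combination e2
      · linear_combination e3
    · have hs : ({a, b} : Finset (Fin n)) ∈ (Finset.univ : Finset (Fin n)).powersetCard 2 :=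
        Finset.mem_powersetCard.2 ⟨Finset.subset_univ _, Finset.card_pair (ne_of_lt hab)⟩
      have e := congrFun hκ ⟨{a, b}, hs⟩
      simp only [ωκ, LinearMap.pi_apply, LinearMap.add_apply, LinearMap.smul_apply, LinearMap.proj_apply,
        Pi.zero_apply, smul_eq_mul, Finset.min'_pair, Finset.max'_pair, min_eq_left hab.le,
        max_eq_right hab.le] at e
      linear_combination e
    · have hs : ({a, b} : Finset (Fin n)) ∈ (Finset.univ : Finset (Fin n)).powersetCard 2 :=
        Finset.mem_powersetCard.2 ⟨Finset.subset_univ _, Finset.card_pair (ne_of_lt hab)⟩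
      have e := congrFun hΘ ⟨{a, b}, hs⟩
      simpa [ωΘ, LinearMap.pi_apply, LinearMap.proj_apply, Finset.min'_pair, Finset.max'_pair,
        min_eq_left hab.le, max_eq_right hab.le] using e
  -- hence the kernel embeds into the bookkeeping target
  have hk : Module.finrank ℂ ↥(LinearMap.ker Φ) ≤ 14 * n + 2 * n.choose 2 := by
    rw [← mcp_finrank_target n]
    refine LinearMap.finrank_le_finrank_of_injective (f := Ω.comp (LinearMap.ker Φ).subtype) ?_
    refine (injective_iff_map_eq_zero _).2 fun x hx => ?_
    have h := hker x.1 (LinearMap.mem_ker.1 x.2) hx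
    exact Subtype.ext h
  -- rank–nullity and arithmetic
  have hrn := LinearMap.finrank_range_add_finrank_ker Φ
  have hdom : Module.finrank ℂ (Fin 4 × (Fin n × Fin n) → ℂ) = 4 * n ^ 2 := by
    rw [Module.finrank_fintype_fun_eq_card]
    simp only [Fintype.card_prod, Fintype.card_fin]
    ring
  rw [hrange, hdom] at hrn
  have hchoose : 2 * n.choose 2 + n = n ^ 2 := by
    rw [Nat.choose_two_right, Nat.two_mul_div_two_of_even (Nat.even_mul_pred_self n)]
    rcases Nat.exists_eq_add_of_le (show 1 ≤ n by omega) with ⟨m, rfl⟩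
    simp only [Nat.add_sub_cancel_left]
    ring
  generalize n ^ 2 = Q at hrn hchoose ⊢
  omega

end

end Summit.ValiantsHypothesis.ValiantsHypothesis.Theorems.ValuativeFlip
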